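import Summits.Ventures.HodgeRepro.Tier3LemmaRWeilLine

/-!
# The restriction-of-scalars map on exterior powers, `⋀[F₀]^n V → ⋀[K]^n V`, through the base change — the
algebra behind Deligne's direct summand (LEMMA-R-RESIDUE.md §4(b))

Blind re-derivation cell `pub-hodge-repro`, seat `t3-p4` (Tier 3, T3.5 for T3.4 = Lemma R).  Target tree path
`lean/Summits/Ventures/HodgeRepro/Tier3WedgeRestrictScalars.lean`; imports Mathlib and the cell's
`Tier3LemmaRWeilLine` (for `lineSet`; the base change `Φ` of `Tier3WedgeBaseChange` is taken as a hypothesis).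

WHAT THIS FILE STATES.  For a field extension `K/F₀` and a `K`-space `V`, the paper's `∧ⁿ_K V` (the Weil line
`W_F(B) := ∧^{2p}_F H¹(B, ℚ)` of LEMMA-R-RESIDUE.md §4(b); Deligne, LNM 900, Lemma 4.3(b) p0029:L28–L34) is reached
from `∧ⁿ_{F₀} V` by RESTRICTION OF SCALARS:

* `exists_restrictScalars_wedge`: the `F₀`-linear `q : ⋀[F₀]^n V → ⋀[K]^n V`, `v₁ ∧_{F₀} ⋯ ∧ vₙ ↦ v₁ ∧_K ⋯ ∧ vₙ`
  (the `K`-alternating `ιMulti` seen over `F₀`); `surjective_of_ιMulti_eq`: onto for `n ≥ 1`;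
* `baseChange_restrictScalars_update_smul`: through the base change `Φ : K ⊗ ⋀[F₀]^n V ≃ ⋀[K]^n (K ⊗ V)`, the map
  `1 ⊗ q` moves a scalar `b ∈ K` from any slot of a wedge to the target — `(1 ⊗ q) Φ⁻¹ (w₁ ∧ ⋯ ∧ (1 ⊗ b) wⱼ ∧ ⋯ ∧ wₙ)
  = (1 ⊗ b) ((1 ⊗ q) Φ⁻¹ (w₁ ∧ ⋯ ∧ wₙ))` (`Module.Basis.ext_multilinear` on the base change of an `F₀`-basis);
* hence `baseChange_restrictScalars_ιMulti_eq_zero_of_ne`: `1 ⊗ q` KILLS every wedge of eigenvectors carrying two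
  distinct characters `x ≠ x′` of `Gal(K/F₀)` (a `b` with `x(b) ≠ x′(b)` gives `(x(b) − x′(b)) • z = 0`), and
  `baseChange_restrictScalars_ιMulti_smul_of_forall_eq`: on a wedge of `σ`-eigenvectors it produces a `σ`-eigenvector
  (`lTensor_lsmul_eigen_of_diag`: the scalar eigen-relation `(1 ⊗ b) e′(i, x) = x(b) • e′(i, x)` used here is the
  constant-vector case of the diagonal one exported by `Tier3PullbackDictionary.exists_equivariant_eigenbasis_pullback`);
* `exists_snd_ne_of_not_lineSet` / `snd_ofFinEmbEquiv_symm_eq_of_lineSet`: an `n`-subset of `ι × G` (`n = |ι|`) that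
  is not a line `{(i, σ)}` carries two distinct second coordinates; on a line all are `σ`.

The theorem that puts these together — the Weil line `W_F` of the kernel twins IS `∧ⁿ_K V`, `⋀[F₀]^n V = W_F ⊕ ker q`
— is `Tier3WeilLineRestriction.weil_line_restrictScalars`.

HONESTY.  Linear algebra on Mathlib; no definition is introduced (`q` is produced by an existential, every later
statement takes an arbitrary `q` with its defining property); the two `instance`s are `Prop`-valued scalar-tower facts.
HC_CM is NOT proved by anyone in this repository.
-/

set_option autoImplicit false

open TensorProduct Finset

namespace HodgeRepro.Tier3

open HodgeRepro.RouteC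

/-! ### §1 The restriction-of-scalars map on exterior powers -/

section RestrictScalars

variable {F₀ K : Type*} [Field F₀] [Field K] [Algebra F₀ K]
variable {V : Type*} [AddCommGroup V] [Module K V] [Module F₀ V] [IsScalarTower F₀ K V]

/-- The `F₀`-structure of the `K`-exterior algebra of the `K`-space `V` is the restriction of scalars
(a `Prop`-valued instance: Mathlib's `Algebra F₀ (ExteriorAlgebra K V)` is found, the tower is not). -/
instance instIsScalarTowerExteriorAlgebra : IsScalarTower F₀ K (ExteriorAlgebra K V) :=
  RingCon.instIsScalarTowerQuotient _

/-- The same for the `n`-th exterior power `⋀[K]^n V ≤ ExteriorAlgebra K V`. -/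
instance instIsScalarTowerExteriorPower (n : ℕ) : IsScalarTower F₀ K (⋀[K]^n V) :=
  Submodule.isScalarTower _

/-- **The restriction-of-scalars map** `q : ⋀[F₀]^n V →ₗ[F₀] ⋀[K]^n V`, `v₁ ∧_{F₀} ⋯ ∧ vₙ ↦ v₁ ∧_K ⋯ ∧ vₙ`
(the `K`-alternating `ιMulti` seen as an `F₀`-alternating map, through the universal property of `⋀[F₀]^n V`). -/
theorem exists_restrictScalars_wedge (n : ℕ) :
    ∃ q : ⋀[F₀]^n V →ₗ[F₀] ⋀[K]^n V, ∀ v : Fin n → V,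
      q (exteriorPower.ιMulti F₀ n v) = exteriorPower.ιMulti K n v := by
  let ψ₀ : V [⋀^Fin n]→ₗ[F₀] ⋀[K]^n V :=
    { (exteriorPower.ιMulti K n).toMultilinearMap.restrictScalars F₀ with
      map_eq_zero_of_eq' := fun v i j h hij => (exteriorPower.ιMulti K n).map_eq_zero_of_eq v h hij }
  refine ⟨exteriorPower.alternatingMapLinearEquiv ψ₀, fun v => ?_⟩
  simp only [exteriorPower.alternatingMapLinearEquiv_apply_ιMulti]
  rfl

/-- For `n ≥ 1` the restriction-of-scalars map is onto: `c • (v₁ ∧_K ⋯ ∧ vₙ) = (c v₁) ∧_K ⋯ ∧ vₙ` is the image of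
`(c v₁) ∧_{F₀} ⋯ ∧ vₙ`, and such wedges span `⋀[K]^n V`.  (For `n = 0` the map `F₀ → K` is not onto.) -/
theorem surjective_of_ιMulti_eq {n : ℕ} (hn : 0 < n) (q : ⋀[F₀]^n V →ₗ[F₀] ⋀[K]^n V)
    (hq : ∀ v : Fin n → V, q (exteriorPower.ιMulti F₀ n v) = exteriorPower.ιMulti K n v) :
    Function.Surjective q := by
  intro y
  have hy : y ∈ Submodule.span K (Set.range (exteriorPower.ιMulti K n (M := V))) := by
    rw [exteriorPower.ιMulti_span]; exact Submodule.mem_top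
  -- the predicate «every `K`-multiple lies in the range of `q`» is closed under the span operations
  have key : ∀ c : K, c • y ∈ LinearMap.range q := by
    induction hy using Submodule.span_induction with
    | mem z hz =>
      obtain ⟨v, rfl⟩ := hz
      intro c
      refine ⟨exteriorPower.ιMulti F₀ n (Function.update v ⟨0, hn⟩ (c • v ⟨0, hn⟩)), ?_⟩
      rw [hq, AlternatingMap.map_update_smul, Function.update_eq_self]
    | zero => intro c; rw [smul_zero]; exact Submodule.zero_mem _
    | add z₁ z₂ _ _ h₁ h₂ => intro c; rw [smul_add]; exact Submodule.add_mem _ (h₁ c) (h₂ c)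
    | smul d z _ h => intro c; rw [smul_smul]; exact h (c * d)
  simpa using key 1

end RestrictScalars

/-! ### §2 `1 ⊗ q` through the base change: a scalar moves from any slot of a wedge to the target -/

section Commutation

variable {F₀ K : Type*} [Field F₀] [Field K] [Algebra F₀ K]
variable {V : Type*} [AddCommGroup V] [Module K V] [Module F₀ V] [IsScalarTower F₀ K V]

/-- **Scalars move through `1 ⊗ q`.**  Under the base change `Φ : K ⊗ ⋀[F₀]^n V ≃ ⋀[K]^n (K ⊗ V)` of
`Tier3WedgeBaseChange`, multiplying the `j`-th slot of a wedge by `1 ⊗ b` (`b ∈ K` acting on `V`) and applying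
`(1 ⊗ q) ∘ Φ⁻¹` is the same as applying `(1 ⊗ q) ∘ Φ⁻¹` and then `1 ⊗ b` (`b` acting on `⋀[K]^n V`): both sides are
`K`-multilinear in the slots and agree on the pure tensors `1 ⊗ vᵢ`, where `q` turns `v₁ ∧_{F₀} ⋯ ∧ (b vⱼ) ∧ ⋯` into
`b • (v₁ ∧_K ⋯ ∧ vₙ)` (`ιMulti_K` is `K`-multilinear). -/
theorem baseChange_restrictScalars_update_smul (n : ℕ) (q : ⋀[F₀]^n V →ₗ[F₀] ⋀[K]^n V)
    (hq : ∀ v : Fin n → V, q (exteriorPower.ιMulti F₀ n v) = exteriorPower.ιMulti K n v)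
    (Φ : K ⊗[F₀] ⋀[F₀]^n V ≃ₗ[K] ⋀[K]^n (K ⊗[F₀] V))
    (hΦ : ∀ (k : K) (v : Fin n → V),
      Φ (k ⊗ₜ[F₀] exteriorPower.ιMulti F₀ n v) = k • exteriorPower.ιMulti K n (fun i => (1 : K) ⊗ₜ[F₀] v i))
    (w : Fin n → K ⊗[F₀] V) (j : Fin n) (b : K) :
    q.baseChange K (Φ.symm (exteriorPower.ιMulti K n
        (Function.update w j (LinearMap.lTensor K ((LinearMap.lsmul K V b).restrictScalars F₀) (w j))))) =
      LinearMap.lTensor K ((LinearMap.lsmul K (⋀[K]^n V) b).restrictScalars F₀)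
        (q.baseChange K (Φ.symm (exteriorPower.ιMulti K n w))) := by
  classical
  -- the `K`-linear forms of the two scalar actions and of `(1 ⊗ q) ∘ Φ⁻¹`
  set T : K ⊗[F₀] V →ₗ[K] K ⊗[F₀] V := ((LinearMap.lsmul K V b).restrictScalars F₀).baseChange K with hT
  set T' : K ⊗[F₀] ⋀[K]^n V →ₗ[K] K ⊗[F₀] ⋀[K]^n V :=
    ((LinearMap.lsmul K (⋀[K]^n V) b).restrictScalars F₀).baseChange K with hT'
  set S : ⋀[K]^n (K ⊗[F₀] V) →ₗ[K] K ⊗[F₀] ⋀[K]^n V := q.baseChange K ∘ₗ Φ.symm.toLinearMap with hS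
  have hS1 : ∀ u : Fin n → V,
      S (exteriorPower.ιMulti K n (fun i => (1 : K) ⊗ₜ[F₀] u i)) = (1 : K) ⊗ₜ[F₀] exteriorPower.ιMulti K n u := by
    intro u
    have h1 : exteriorPower.ιMulti K n (fun i => (1 : K) ⊗ₜ[F₀] u i) =
        Φ ((1 : K) ⊗ₜ[F₀] exteriorPower.ιMulti F₀ n u) := by
      rw [hΦ, one_smul]
    rw [h1]
    simp only [hS, LinearMap.comp_apply, LinearEquiv.coe_coe, LinearEquiv.symm_apply_apply,
      LinearMap.baseChange_tmul, hq]
  have hT1 : ∀ v : V, T ((1 : K) ⊗ₜ[F₀] v) = (1 : K) ⊗ₜ[F₀] (b • v) := by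
    intro v
    simp only [hT, LinearMap.baseChange_tmul, LinearMap.coe_restrictScalars, LinearMap.lsmul_apply]
  have hT'1 : ∀ z : ⋀[K]^n V, T' ((1 : K) ⊗ₜ[F₀] z) = (1 : K) ⊗ₜ[F₀] (b • z) := by
    intro z
    simp only [hT', LinearMap.baseChange_tmul, LinearMap.coe_restrictScalars, LinearMap.lsmul_apply]
  -- the two `K`-multilinear maps
  let f₁ : MultilinearMap K (fun _ : Fin n => K ⊗[F₀] V) (K ⊗[F₀] ⋀[K]^n V) :=
    S.compMultilinearMap
      ((exteriorPower.ιMulti K n).toMultilinearMap.compLinearMap (Function.update (fun _ => LinearMap.id) j T))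
  let f₂ : MultilinearMap K (fun _ : Fin n => K ⊗[F₀] V) (K ⊗[F₀] ⋀[K]^n V) :=
    (T' ∘ₗ S).compMultilinearMap (exteriorPower.ιMulti K n).toMultilinearMap
  have hupd : ∀ (u : Fin n → V),
      (fun i => Function.update (fun _ => LinearMap.id) j T i ((1 : K) ⊗ₜ[F₀] u i)) =
        fun i => (1 : K) ⊗ₜ[F₀] Function.update u j (b • u j) i := by
    intro u
    funext i
    by_cases hij : i = j
    · subst hij
      simp only [Function.update_self, hT1]
    · simp only [Function.update_of_ne hij, LinearMap.id_apply]
  have hf : f₁ = f₂ := by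
    let β := Module.Free.chooseBasis F₀ V
    refine Module.Basis.ext_multilinear (fun _ => β.baseChange K) fun v => ?_
    simp only [f₁, f₂, LinearMap.compMultilinearMap_apply, MultilinearMap.compLinearMap_apply,
      AlternatingMap.coe_multilinearMap, Module.Basis.baseChange_apply, LinearMap.comp_apply]
    rw [hupd, hS1, hS1, AlternatingMap.map_update_smul, Function.update_eq_self, hT'1]
  -- evaluate at `w`
  have hw := MultilinearMap.congr_fun hf w
  simp only [f₁, f₂, LinearMap.compMultilinearMap_apply, MultilinearMap.compLinearMap_apply,
    AlternatingMap.coe_multilinearMap, LinearMap.comp_apply] at hw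
  have hupdw : (fun i => Function.update (fun _ => LinearMap.id) j T i (w i)) =
      Function.update w j (LinearMap.lTensor K ((LinearMap.lsmul K V b).restrictScalars F₀) (w j)) := by
    funext i
    by_cases hij : i = j
    · subst hij
      simp only [Function.update_self]
      rfl
    · simp only [Function.update_of_ne hij, LinearMap.id_apply]
  rw [hupdw] at hw
  exact hw

/-- **`1 ⊗ q` kills a wedge of eigenvectors with two distinct characters.**  If `(1 ⊗ b) wᵢ = xᵢ(b) • wᵢ` for
characters `xᵢ : K ≃ₐ[F₀] K` and `x_{j₁} ≠ x_{j₂}`, some `b` has `x_{j₁}(b) ≠ x_{j₂}(b)`, and moving `b` through either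
slot gives `x_{j₁}(b) • z = (1 ⊗ b) z = x_{j₂}(b) • z` for `z := (1 ⊗ q) Φ⁻¹ (w₁ ∧ ⋯ ∧ wₙ)`, so `z = 0`. -/
theorem baseChange_restrictScalars_ιMulti_eq_zero_of_ne (n : ℕ) (q : ⋀[F₀]^n V →ₗ[F₀] ⋀[K]^n V)
    (hq : ∀ v : Fin n → V, q (exteriorPower.ιMulti F₀ n v) = exteriorPower.ιMulti K n v)
    (Φ : K ⊗[F₀] ⋀[F₀]^n V ≃ₗ[K] ⋀[K]^n (K ⊗[F₀] V))
    (hΦ : ∀ (k : K) (v : Fin n → V),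
      Φ (k ⊗ₜ[F₀] exteriorPower.ιMulti F₀ n v) = k • exteriorPower.ιMulti K n (fun i => (1 : K) ⊗ₜ[F₀] v i))
    (w : Fin n → K ⊗[F₀] V) (x : Fin n → K ≃ₐ[F₀] K)
    (hw : ∀ (i : Fin n) (b : K),
      LinearMap.lTensor K ((LinearMap.lsmul K V b).restrictScalars F₀) (w i) = x i b • w i)
    {j₁ j₂ : Fin n} (hne : x j₁ ≠ x j₂) :
    q.baseChange K (Φ.symm (exteriorPower.ιMulti K n w)) = 0 := by
  classical
  obtain ⟨b, hb⟩ : ∃ b : K, x j₁ b ≠ x j₂ b := by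
    by_contra h
    exact hne (AlgEquiv.ext fun b => of_not_not (not_exists.mp h b))
  set z := q.baseChange K (Φ.symm (exteriorPower.ιMulti K n w)) with hz
  have key : ∀ j : Fin n, x j b • z =
      LinearMap.lTensor K ((LinearMap.lsmul K (⋀[K]^n V) b).restrictScalars F₀) z := by
    intro j
    have h := baseChange_restrictScalars_update_smul n q hq Φ hΦ w j b
    rw [hw j b, AlternatingMap.map_update_smul, Function.update_eq_self, map_smul, map_smul] at h
    exact h
  have h0 : (x j₁ b - x j₂ b) • z = 0 := by
    have h1 := sub_smul (x j₁ b) (x j₂ b) z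
    rw [h1, key j₁, key j₂, sub_self]
  exact (smul_eq_zero.mp h0).resolve_left (sub_ne_zero.mpr hb)

/-- **On a wedge of `σ`-eigenvectors, `(1 ⊗ q) Φ⁻¹` produces a `σ`-eigenvector** of `K ⊗ ⋀[K]^n V` (`n ≥ 1`). -/
theorem baseChange_restrictScalars_ιMulti_smul_of_forall_eq {n : ℕ} (hn : 0 < n)
    (q : ⋀[F₀]^n V →ₗ[F₀] ⋀[K]^n V)
    (hq : ∀ v : Fin n → V, q (exteriorPower.ιMulti F₀ n v) = exteriorPower.ιMulti K n v)
    (Φ : K ⊗[F₀] ⋀[F₀]^n V ≃ₗ[K] ⋀[K]^n (K ⊗[F₀] V))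
    (hΦ : ∀ (k : K) (v : Fin n → V),
      Φ (k ⊗ₜ[F₀] exteriorPower.ιMulti F₀ n v) = k • exteriorPower.ιMulti K n (fun i => (1 : K) ⊗ₜ[F₀] v i))
    (w : Fin n → K ⊗[F₀] V) (σ : K ≃ₐ[F₀] K)
    (hw : ∀ (i : Fin n) (b : K),
      LinearMap.lTensor K ((LinearMap.lsmul K V b).restrictScalars F₀) (w i) = σ b • w i) (b : K) :
    LinearMap.lTensor K ((LinearMap.lsmul K (⋀[K]^n V) b).restrictScalars F₀)
        (q.baseChange K (Φ.symm (exteriorPower.ιMulti K n w))) =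
      σ b • q.baseChange K (Φ.symm (exteriorPower.ιMulti K n w)) := by
  classical
  have h := baseChange_restrictScalars_update_smul n q hq Φ hΦ w ⟨0, hn⟩ b
  rw [hw ⟨0, hn⟩ b, AlternatingMap.map_update_smul, Function.update_eq_self, map_smul, map_smul] at h
  exact h.symm

/-- **The scalar eigen-relation is the constant-vector case of the diagonal one.**  If `A′ b` is the diagonal action
`ω′ᵢ ↦ bᵢ • ω′ᵢ` on a `K`-basis `ω′` and `e′` satisfies `(1 ⊗ A′ b) e′(i, x) = x(bᵢ) • e′(i, x)` (the form exported by
`Tier3PullbackDictionary.exists_equivariant_eigenbasis_pullback`), then `(1 ⊗ b) e′(i, x) = x(b) • e′(i, x)` for the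
scalar multiplication by `b ∈ K` on `V` — `A′ (fun _ => b) = lsmul b` on the basis. -/
theorem lTensor_lsmul_eigen_of_diag {ι : Type*} (ω' : Module.Basis ι K V) (A' : (ι → K) → V →ₗ[K] V)
    (hA' : ∀ (b : ι → K) (i : ι), A' b (ω' i) = b i • ω' i)
    (e' : ι × (K ≃ₐ[F₀] K) → K ⊗[F₀] V)
    (he2' : ∀ (x : K ≃ₐ[F₀] K) (i : ι) (b : ι → K),
      LinearMap.lTensor K ((A' b).restrictScalars F₀) (e' (i, x)) = x (b i) • e' (i, x))
    (x : K ≃ₐ[F₀] K) (i : ι) (b : K) :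
    LinearMap.lTensor K ((LinearMap.lsmul K V b).restrictScalars F₀) (e' (i, x)) = x b • e' (i, x) := by
  have h : A' (fun _ => b) = LinearMap.lsmul K V b := by
    refine ω'.ext fun j => ?_
    rw [hA', LinearMap.lsmul_apply]
  rw [← h]
  exact he2' x i (fun _ => b)

end Commutation

/-! ### §3 The enumeration of an `n`-subset of `ι × G` and the lines -/

section Lines

variable {G : Type*} [DecidableEq G] {ι : Type*} [Fintype ι] [DecidableEq ι] [LinearOrder (ι × G)]

/-- An `n`-subset of `ι × G` (`n = |ι|`, `n ≥ 1`) that is NOT a line `{(i, σ) : i ∈ ι}` carries two distinct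
second coordinates (else it sits inside one line and has its cardinality). -/
theorem exists_snd_ne_of_not_lineSet {n : ℕ} (hn : Fintype.card ι = n) (hn0 : 0 < n)
    (L : Set.powersetCard (ι × G) n) (hL : ¬ ∃ σ : G, (L : Finset (ι × G)) = lineSet σ) :
    ∃ j₁ j₂ : Fin n,
      ((Set.powersetCard.ofFinEmbEquiv.symm L) j₁).2 ≠ ((Set.powersetCard.ofFinEmbEquiv.symm L) j₂).2 := by
  by_contra h
  have h' : ∀ j₁ j₂ : Fin n,
      ((Set.powersetCard.ofFinEmbEquiv.symm L) j₁).2 = ((Set.powersetCard.ofFinEmbEquiv.symm L) j₂).2 :=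
    fun j₁ j₂ => of_not_not (not_exists.mp (not_exists.mp h j₁) j₂)
  set σ : G := ((Set.powersetCard.ofFinEmbEquiv.symm L) ⟨0, hn0⟩).2 with hσ
  refine hL ⟨σ, Finset.eq_of_subset_of_card_le ?_ ?_⟩
  · intro p hp
    obtain ⟨j, hj⟩ := (Set.powersetCard.mem_range_ofFinEmbEquiv_symm_iff_mem L p).mpr hp
    rw [mem_lineSet, ← hj, hσ]
    exact h' j ⟨0, hn0⟩
  · rw [card_lineSet, hn]
    exact (Set.powersetCard.mem_iff.mp L.prop).ge

/-- On a line `{(i, σ) : i ∈ ι}` every enumerated element has second coordinate `σ`. -/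
theorem snd_ofFinEmbEquiv_symm_eq_of_lineSet {n : ℕ} (L : Set.powersetCard (ι × G) n) (σ : G)
    (hL : (L : Finset (ι × G)) = lineSet σ) (j : Fin n) :
    ((Set.powersetCard.ofFinEmbEquiv.symm L) j).2 = σ := by
  have hmem : (Set.powersetCard.ofFinEmbEquiv.symm L) j ∈ (L : Finset (ι × G)) :=
    (Set.powersetCard.mem_range_ofFinEmbEquiv_symm_iff_mem L _).mp ⟨j, rfl⟩
  rw [hL] at hmem
  exact mem_lineSet.mp hmem

end Lines

end HodgeRepro.Tier3
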